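import Mathlib.Data.Nat.Bitwise
import Mathlib.Data.List.Basic
import HarnessLib

/-!
# A kernel-evaluable RUP (reverse unit propagation) certificate checker for CNF refutations — machinery and soundness

Framing (verbatim for the cell): lottery ticket; floor = certified bounds/negative ranges.

Cell `pub-namedobj`, target (U), seat udg g12.  Companion of `KernelColouringSearch.lean` (udg g7) for instances whose
backtracking tree is too large for the kernel but whose CDCL refutation is short: the external solver (`code/udg12/cdcl.c`)
emits, for every learnt clause, the list of clause ids that become unit, in order, under the negation of the clause
(an LRAT-style hint list without deletions); the kernel re-plays the unit propagations.

Encoding.  A literal is a natural number `l` with variable `l / 2` and polarity `l % 2` (`0` = positive); a clause is a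
`List ℕ` (disjunction); an assignment of the variables is `σ : ℕ → Bool`.  During a check the set of literals currently
assumed TRUE is a bit-set `A : ℕ`.  Clauses are kept in a binary trie `Store` keyed by their id (original clauses `1 … m`,
derived clauses `m+1, …` in order).  `rup S f A hs` follows the hints `hs`: each hinted clause must have all but at most one
literal falsified by `A`; no free literal = conflict = success, one free literal `u` = assume `u`.  `checkAll` runs a list
of steps `(C, hints)`, inserting each checked clause.  SOUNDNESS (`checkAll_sound`): if every clause in the store is true
under `σ` then every checked clause is true under `σ`; in particular a checked EMPTY clause refutes `σ`
(`checkAll_refutes`).  Soundness uses only 'every clause fetched from the store was inserted', never the trie's indexing.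
All recursion is structural (fuel arguments), so `decide +kernel` evaluates the checker.
-/

namespace Summit.Ventures.DiscreteObjects.UnitDistance.KRup

/-! ## Literals, clauses, assignments -/

/-- Truth value of literal `l` under the variable assignment `σ`. -/
def litTrue (σ : ℕ → Bool) (l : ℕ) : Bool := σ (l / 2) == (l % 2 == 0)

/-- A clause (list of literals, read disjunctively) is true under `σ`. -/
def clauseTrue (σ : ℕ → Bool) (C : List ℕ) : Bool := C.any (litTrue σ)

/-- The complementary literal. -/
def neg (l : ℕ) : ℕ := if l % 2 = 0 then l + 1 else l - 1

/-- Complementary literals have the same variable. -/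
theorem neg_div_two (l : ℕ) : neg l / 2 = l / 2 := by
  unfold neg; split <;> omega

/-- The complementary literal has the complementary truth value. -/
theorem litTrue_neg (σ : ℕ → Bool) (l : ℕ) : litTrue σ (neg l) = !litTrue σ l := by
  unfold litTrue
  rw [neg_div_two]
  have h : (neg l % 2 == 0) = !(l % 2 == 0) := by
    unfold neg; split <;> rename_i h
    · have : (l + 1) % 2 = 1 := by omega
      simp [this, h]
    · have h1 : l % 2 = 1 := by omega
      have : (l - 1) % 2 = 0 := by omega
      simp [this, h1]
  rw [h]
  cases σ (l / 2) <;> cases (l % 2 == 0) <;> rfl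

/-! ## Clause store (binary trie on the id; soundness never uses the indexing) -/

/-- Binary trie of clauses. -/
inductive Store where
  | nil : Store
  | node : Store → Option (List ℕ) → Store → Store

/-- Lookup by id (`k ≥ 1`; path = binary digits of `k`). -/
def Store.get : Store → ℕ → Option (List ℕ)
  | .nil, _ => none
  | .node l v r, k => if k ≤ 1 then v else if k % 2 = 0 then l.get (k / 2) else r.get (k / 2)

/-- Insert clause `C` at id `k` (`d` = depth fuel ≥ number of binary digits of `k`). -/
def Store.ins : ℕ → Store → ℕ → List ℕ → Store
  | 0, t, _, _ => t
  | d + 1, .nil, k, C =>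
      if k ≤ 1 then .node .nil (some C) .nil
      else if k % 2 = 0 then .node (Store.ins d .nil (k / 2) C) none .nil
      else .node .nil none (Store.ins d .nil (k / 2) C)
  | d + 1, .node l v r, k, C =>
      if k ≤ 1 then .node l (some C) r
      else if k % 2 = 0 then .node (Store.ins d l (k / 2) C) v r
      else .node l v (Store.ins d r (k / 2) C)

/-- Insert a list of clauses with consecutive ids starting at `i`. -/
def Store.insList (d : ℕ) : Store → ℕ → List (List ℕ) → Store
  | t, _, [] => t
  | t, i, C :: rest => Store.insList d (t.ins d i C) (i + 1) rest

/-- Every clause stored in `t` satisfies `P`. -/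
def Store.All (P : List ℕ → Prop) : Store → Prop
  | .nil => True
  | .node l v r => l.All P ∧ (∀ C, v = some C → P C) ∧ r.All P

/-- A clause fetched from a store all of whose clauses satisfy `P` satisfies `P`. -/
theorem Store.All.get {P : List ℕ → Prop} : ∀ {t : Store}, t.All P → ∀ {k : ℕ} {C : List ℕ}, t.get k = some C → P C
  | .nil, _, k, C, h => by simp [Store.get] at h
  | .node l v r, ⟨hl, hv, hr⟩, k, C, h => by
      unfold Store.get at h
      split at h
      · exact hv C h
      · split at h
        · exact Store.All.get hl h
        · exact Store.All.get hr h

/-- The empty store satisfies every predicate. -/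
theorem Store.All_nil (P : List ℕ → Prop) : Store.All P .nil := trivial

/-- Inserting a clause satisfying `P` preserves `Store.All P`. -/
theorem Store.All.ins {P : List ℕ → Prop} {C : List ℕ} (hC : P C) :
    ∀ (d : ℕ) (t : Store), t.All P → ∀ (k : ℕ), (t.ins d k C).All P
  | 0, t, ht, k => by simpa [Store.ins] using ht
  | d + 1, .nil, _, k => by
      unfold Store.ins
      by_cases h1 : k ≤ 1
      · rw [if_pos h1]
        exact ⟨Store.All_nil P, fun C' h => by simp only [Option.some.injEq] at h; exact h ▸ hC, Store.All_nil P⟩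
      · rw [if_neg h1]
        by_cases h2 : k % 2 = 0
        · rw [if_pos h2]
          exact ⟨Store.All.ins hC d .nil (Store.All_nil P) _, fun C' h => by simp at h, Store.All_nil P⟩
        · rw [if_neg h2]
          exact ⟨Store.All_nil P, fun C' h => by simp at h, Store.All.ins hC d .nil (Store.All_nil P) _⟩
  | d + 1, .node l v r, ⟨hl, hv, hr⟩, k => by
      unfold Store.ins
      by_cases h1 : k ≤ 1
      · rw [if_pos h1]
        exact ⟨hl, fun C' h => by simp only [Option.some.injEq] at h; exact h ▸ hC, hr⟩
      · rw [if_neg h1]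
        by_cases h2 : k % 2 = 0
        · rw [if_pos h2]; exact ⟨Store.All.ins hC d l hl _, hv, hr⟩
        · rw [if_neg h2]; exact ⟨hl, hv, Store.All.ins hC d r hr _⟩

/-- Inserting a list of clauses satisfying `P` preserves `Store.All P`. -/
theorem Store.All.insList {P : List ℕ → Prop} (d : ℕ) :
    ∀ {t : Store} (i : ℕ) {L : List (List ℕ)}, t.All P → (∀ C ∈ L, P C) → (t.insList d i L).All P
  | t, i, [], ht, _ => by simpa [Store.insList] using ht
  | t, i, C :: rest, ht, hL => by
      unfold Store.insList
      exact Store.All.insList d (i + 1) (Store.All.ins (hL C (by simp)) d t ht i) fun C' hC' => hL C' (by simp [hC'])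

/-- The store of a clause list with ids `1, 2, …`. -/
def Store.ofList (d : ℕ) (L : List (List ℕ)) : Store := Store.insList d .nil 1 L

/-- The store of a list of clauses satisfying `P` satisfies `Store.All P`. -/
theorem Store.All.ofList {P : List ℕ → Prop} (d : ℕ) {L : List (List ℕ)} (hL : ∀ C ∈ L, P C) :
    (Store.ofList d L).All P :=
  Store.All.insList d 1 (Store.All_nil _) hL

/-! ## The RUP check -/

/-- Scan clause `D` under the assumed-true literal set `A`: number of non-falsified literals and the last one seen. -/
def scan (A : ℕ) : List ℕ → ℕ × ℕ
  | [] => (0, 0)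
  | l :: D => if Nat.testBit A (neg l) then scan A D else ((scan A D).1 + 1, l)

/-- Follow the hints: every hinted clause must be unit (assume its free literal) until one is falsified (success). -/
def rup (S : Store) : ℕ → ℕ → List ℕ → Bool
  | 0, _, _ => false
  | _ + 1, _, [] => false
  | f + 1, A, h :: hs =>
      match S.get h with
      | none => false
      | some D =>
          if (scan A D).1 = 0 then true
          else if (scan A D).1 = 1 then rup S f (Nat.lor A (2 ^ (scan A D).2)) hs
          else false

/-- Assume the negation of clause `C`: all complementary literals true. -/
def assume : List ℕ → ℕ
  | [] => 0
  | l :: C => Nat.lor (assume C) (2 ^ neg l)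

/-- Check a list of steps `(C, hints)` against the store, inserting each checked clause at ids `i, i+1, …`
(`f` = hint fuel, `d` = trie depth fuel). -/
def checkAll (f d : ℕ) : Store → ℕ → List (List ℕ × List ℕ) → Bool
  | _, _, [] => true
  | S, i, (C, hs) :: rest => rup S f (assume C) hs && checkAll f d (S.ins d i C) (i + 1) rest

/-! ## Soundness -/

/-- `A` is consistent with `σ`: every assumed literal is true under `σ`. -/
def Cons (σ : ℕ → Bool) (A : ℕ) : Prop := ∀ l, Nat.testBit A l = true → litTrue σ l = true

/-- Assuming one more literal that is true under `σ` keeps the assumption set consistent. -/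
theorem cons_lor {σ : ℕ → Bool} {A : ℕ} (hA : Cons σ A) {u : ℕ} (hu : litTrue σ u = true) :
    Cons σ (Nat.lor A (2 ^ u)) := by
  intro l hl
  rw [show Nat.lor A (2 ^ u) = A ||| 2 ^ u from rfl, Nat.testBit_lor, Nat.testBit_two_pow] at hl
  rcases Bool.or_eq_true_iff.1 hl with h | h
  · exact hA l h
  · rw [decide_eq_true_eq] at h; exact h ▸ hu

/-- If clause `D` is true under `σ` and `A` is consistent, the scan finds a non-falsified literal; if it finds exactly one,
that literal is true under `σ`. -/
theorem scan_sound {σ : ℕ → Bool} {A : ℕ} (hA : Cons σ A) :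
    ∀ (D : List ℕ), clauseTrue σ D = true →
      (scan A D).1 ≠ 0 ∧ ((scan A D).1 = 1 → litTrue σ (scan A D).2 = true)
  | [], h => by simp [clauseTrue] at h
  | l :: D, h => by
      have hD : clauseTrue σ (l :: D) = (litTrue σ l || clauseTrue σ D) := by simp [clauseTrue]
      rw [hD] at h
      unfold scan
      split
      · rename_i hneg
        -- `neg l` assumed true ⇒ `l` false under σ ⇒ the rest of the clause is true
        have hl : litTrue σ l = false := by
          have := hA _ hneg
          rw [litTrue_neg] at this
          simpa using this
        rw [hl, Bool.false_or] at h
        exact scan_sound hA D h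
      · rename_i hneg
        refine ⟨by simp, fun h1 => ?_⟩
        simp only [Nat.add_eq_right] at h1
        -- the rest of the clause has no free literal, hence is false under σ; so `l` is true
        by_cases hDt : clauseTrue σ D = true
        · exact absurd h1 (scan_sound hA D hDt).1
        · simp only [Bool.not_eq_true] at hDt
          rw [hDt, Bool.or_false] at h
          exact h

/-- SOUNDNESS OF `rup`: a successful check from a consistent assumption set is impossible when every stored clause is true. -/
theorem rup_sound {σ : ℕ → Bool} {S : Store} (hS : S.All fun C => clauseTrue σ C = true) :
    ∀ (f : ℕ) {A : ℕ}, Cons σ A → ∀ (hs : List ℕ), rup S f A hs = true → False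
  | 0, A, _, hs, h => by simp [rup] at h
  | f + 1, A, _, [], h => by simp [rup] at h
  | f + 1, A, hA, hh :: hs, h => by
      unfold rup at h
      split at h
      · simp at h
      · rename_i D hget
        have hD := Store.All.get hS hget
        obtain ⟨h0, h1⟩ := scan_sound hA D hD
        split at h
        · rename_i hz; exact h0 hz
        · split at h
          · rename_i hone
            exact rup_sound hS f (cons_lor hA (h1 hone)) hs h
          · simp at h

/-- If `C` is false under `σ` then assuming its negation is consistent. -/
theorem cons_assume {σ : ℕ → Bool} : ∀ (C : List ℕ), clauseTrue σ C = false → Cons σ (assume C)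
  | [], _ => fun l hl => by simp [assume] at hl
  | l :: C, h => by
      have hC : clauseTrue σ (l :: C) = (litTrue σ l || clauseTrue σ C) := by simp [clauseTrue]
      rw [hC, Bool.or_eq_false_iff] at h
      unfold assume
      refine cons_lor (cons_assume C h.2) ?_
      rw [litTrue_neg, h.1]; rfl

/-- SOUNDNESS OF `checkAll`: if every stored clause is true under `σ`, every checked clause is true under `σ`. -/
theorem checkAll_sound {σ : ℕ → Bool} (f d : ℕ) :
    ∀ {S : Store} (i : ℕ) (steps : List (List ℕ × List ℕ)), (S.All fun C => clauseTrue σ C = true) →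
      checkAll f d S i steps = true → ∀ C ∈ steps.map Prod.fst, clauseTrue σ C = true
  | S, i, [], _, _, C, hC => by simp at hC
  | S, i, (C₀, hs) :: rest, hS, h, C, hC => by
      unfold checkAll at h
      rw [Bool.and_eq_true] at h
      have hC₀ : clauseTrue σ C₀ = true := by
        by_contra hf
        simp only [Bool.not_eq_true] at hf
        exact rup_sound hS f (cons_assume C₀ hf) hs h.1
      simp only [List.map_cons, List.mem_cons] at hC
      rcases hC with rfl | hC
      · exact hC₀
      · exact checkAll_sound f d (i + 1) rest (Store.All.ins hC₀ d S hS i) h.2 C (by simpa using hC)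

/-- A checked step list containing the EMPTY clause refutes `σ`. -/
theorem checkAll_refutes {σ : ℕ → Bool} {f d : ℕ} {S : Store} {i : ℕ} {steps : List (List ℕ × List ℕ)}
    (hS : S.All fun C => clauseTrue σ C = true) (h : checkAll f d S i steps = true)
    (hnil : [] ∈ steps.map Prod.fst) : False := by
  have := checkAll_sound f d i steps hS h [] hnil
  simp [clauseTrue] at this

end Summit.Ventures.DiscreteObjects.UnitDistance.KRup
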